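import Mathlib
import HarnessLib

/-!
# Littlewood–Offord / Erdős anti-concentration for biased independent signs (stub S4)

For independent signs `s_i = ±1` with `P(s_i = +1) = p_i ∈ [ε, 1 - ε]`, every atom of the law
of `∑ i s_i` is at most `C(ε) / √(N+1)`.  The probability is written as a finite sum over sign
patterns `s : Fin N → Bool` of product weights.

Proof (purely combinatorial "mixture" argument): write `p_i = ε + (p_i - ε)` and
`1 - p_i = ε + (1 - p_i - ε)` and expand the product (`Finset.prod_add`); this exhibits the law
as a mixture over a random set `T` of "fair" coordinates.  Conditionally on `T` and on the
coordinates outside `T`, an atom is a count of sign patterns on `T` with prescribed number of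
`+1`'s, hence at most the middle binomial coefficient `binom(|T|, |T|/2) ≤ 2^|T| / √(|T|+1)`.
Averaging `1/√(|T|+1)` against the binomial law of `|T|` (parameter `2ε`) gives the claim with
`C = 1 + 1/(4ε)`.
-/

noncomputable section

namespace Summit.QuantumFields.QCD.Cruxes.WindowExtinction.FreeVolumeHeavyWitness

open Finset
open scoped BigOperators

/-- Central binomial bound with the correct polynomial factor:
`(2n+1) · binom(2n,n)² ≤ 16^n`. -/
private theorem centralBinom_sq_bound (n : ℕ) :
    (2 * n + 1) * Nat.centralBinom n ^ 2 ≤ 16 ^ n := by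
  induction n with
  | zero => simp
  | succ n ih =>
    have h := Nat.succ_mul_centralBinom_succ n
    have hpos : 0 < (n + 1) ^ 2 := by positivity
    refine Nat.le_of_mul_le_mul_left ?_ hpos
    have hq : (2 * n + 3) * (2 * n + 1) ≤ 4 * (n + 1) ^ 2 := by nlinarith
    calc (n + 1) ^ 2 * ((2 * (n + 1) + 1) * Nat.centralBinom (n + 1) ^ 2)
        = (2 * n + 3) * ((n + 1) * Nat.centralBinom (n + 1)) ^ 2 := by ring
      _ = 4 * ((2 * n + 3) * (2 * n + 1)) * ((2 * n + 1) * Nat.centralBinom n ^ 2) := by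
          rw [h]; ring
      _ ≤ 4 * (4 * (n + 1) ^ 2) * 16 ^ n := by gcongr
      _ = (n + 1) ^ 2 * 16 ^ (n + 1) := by ring

/-- Middle binomial coefficient bound: `(M+1) · binom(M, ⌊M/2⌋)² ≤ 4^M`. -/
private theorem middle_choose_sq_bound (M : ℕ) :
    (M + 1) * M.choose (M / 2) ^ 2 ≤ 4 ^ M := by
  obtain ⟨n, rfl | rfl⟩ := Nat.even_or_odd' M
  · have h1 : 2 * n / 2 = n := by omega
    rw [h1, ← Nat.centralBinom_eq_two_mul_choose, pow_mul]
    exact centralBinom_sq_bound n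
  · have h1 : (2 * n + 1) / 2 = n := by omega
    rw [h1]
    have h2 : Nat.centralBinom (n + 1) = 2 * (2 * n + 1).choose n := by
      rw [Nat.centralBinom_eq_two_mul_choose, show 2 * (n + 1) = (2 * n + 1) + 1 by ring,
        Nat.choose_succ_succ', Nat.choose_symm_half]
      ring
    have h3 := centralBinom_sq_bound (n + 1)
    rw [h2] at h3
    have h5 : 4 * ((2 * n + 3) * (2 * n + 1).choose n ^ 2) ≤ 4 * 4 ^ (2 * n + 1) := by
      calc 4 * ((2 * n + 3) * (2 * n + 1).choose n ^ 2)
          = (2 * (n + 1) + 1) * (2 * (2 * n + 1).choose n) ^ 2 := by ring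
        _ ≤ 16 ^ (n + 1) := h3
        _ = 4 * 4 ^ (2 * n + 1) := by
          rw [show (16 : ℕ) = 4 ^ 2 by norm_num, ← pow_mul]; ring
    have h6 := Nat.le_of_mul_le_mul_left h5 (by norm_num)
    calc (2 * n + 1 + 1) * (2 * n + 1).choose n ^ 2 ≤ (2 * n + 3) * (2 * n + 1).choose n ^ 2 :=
          Nat.mul_le_mul_right _ (by omega)
      _ ≤ _ := h6

/-- Fair-coin atoms: the number of sign patterns on a finite type `κ` with prescribed signed
sum `j` is at most the middle binomial coefficient `binom(|κ|, |κ|/2)`. -/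
private theorem card_signs_eq_le (κ : Type*) [Fintype κ] [DecidableEq κ] (j : ℤ) :
    #((univ : Finset (κ → Bool)).filter
        (fun a => (∑ i, (if a i then (1 : ℤ) else -1)) = j))
      ≤ (Fintype.card κ).choose (Fintype.card κ / 2) := by
  set m : ℕ := Int.toNat ((j + Fintype.card κ) / 2) with hm
  calc #((univ : Finset (κ → Bool)).filter (fun a => (∑ i, (if a i then (1 : ℤ) else -1)) = j))
      ≤ #(powersetCard m (univ : Finset κ)) := by
        refine card_le_card_of_injOn (fun a => univ.filter (fun i => a i = true)) ?_ ?_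
        · intro a ha
          simp only [coe_filter, Set.mem_setOf_eq, mem_univ, true_and] at ha
          rw [mem_coe, mem_powersetCard]
          refine ⟨subset_univ _, ?_⟩
          beta_reduce
          have h1 : (∑ i, (if a i then (1 : ℤ) else -1))
              = (#(univ.filter (fun i => a i = true)) : ℤ)
                - (#(univ.filter (fun i => ¬ (a i = true))) : ℤ) := by
            rw [Finset.sum_ite, sum_const, sum_const, nsmul_eq_mul, nsmul_eq_mul]
            ring
          have h2 := card_filter_add_card_filter_not (s := (univ : Finset κ)) (fun i => a i = true)
          rw [card_univ] at h2
          rw [h1] at ha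
          omega
        · intro a _ b _ hab
          funext i
          have := congrArg (i ∈ ·) hab
          exact Bool.eq_iff_iff.mpr (by simpa using this)
    _ = (Fintype.card κ).choose m := by rw [card_powersetCard, card_univ]
    _ ≤ _ := Nat.choose_le_middle m _

/-- Conditioning step: if the weight of a sign pattern only depends on the coordinates outside a
set `T`, then the total weight of the patterns with prescribed signed sum `k` is at most the
middle binomial coefficient of `|T|` times the total weight of the outside coordinates. -/
private theorem sum_filter_prod_sdiff_le (N : ℕ) (T : Finset (Fin N)) (r : Fin N → Bool → ℝ)
    (hr : ∀ i b, 0 ≤ r i b) (k : ℤ) :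
    ∑ s ∈ (univ : Finset (Fin N → Bool)).filter
        (fun s => (∑ i, (if s i then (1 : ℤ) else -1)) = k), ∏ i ∈ univ \ T, r i (s i)
      ≤ (T.card.choose (T.card / 2) : ℝ) * ∏ i ∈ univ \ T, (r i true + r i false) := by
  classical
  set e := Equiv.piEquivPiSubtypeProd (· ∈ T) (fun _ : Fin N => Bool) with he
  have hsub : ∀ x : Fin N, x ∈ univ \ T ↔ ¬ (x ∈ T) := by simp
  have hF : ∀ (a : {x // x ∈ T} → Bool) (b : {x // x ∉ T} → Bool),
      ∏ i ∈ univ \ T, r i (e.symm (a, b) i) = ∏ i : {x // x ∉ T}, r i (b i) := by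
    intro a b
    rw [prod_subtype (univ \ T) hsub]
    refine Fintype.prod_congr _ _ (fun i => ?_)
    simp [he, i.2]
  have hS : ∀ (a : {x // x ∈ T} → Bool) (b : {x // x ∉ T} → Bool),
      (∑ i, (if e.symm (a, b) i then (1 : ℤ) else -1)) =
        (∑ i : {x // x ∈ T}, (if a i then (1 : ℤ) else -1))
          + ∑ i : {x // x ∉ T}, (if b i then (1 : ℤ) else -1) := by
    intro a b
    rw [← Fintype.sum_subtype_add_sum_subtype (· ∈ T)]
    congr 1
    · refine Finset.sum_congr (by ext; simp) (fun i _ => ?_)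
      simp [he, i.2]
    · refine Fintype.sum_congr _ _ (fun i => ?_)
      simp [he, i.2]
  have hG : ∑ b : {x // x ∉ T} → Bool, ∏ i : {x // x ∉ T}, r i (b i)
      = ∏ i ∈ univ \ T, (r i true + r i false) := by
    have h1 := Fintype.prod_sum (fun (i : {x // x ∉ T}) (j : Bool) => r i j)
    simp only [Fintype.sum_bool] at h1
    rw [prod_subtype (univ \ T) hsub (fun i => r i true + r i false)]
    exact h1.symm
  have hGnn : ∀ b : {x // x ∉ T} → Bool, 0 ≤ ∏ i : {x // x ∉ T}, r i (b i) :=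
    fun b => prod_nonneg (fun i _ => hr _ _)
  rw [sum_filter, ← Equiv.sum_comp e.symm, Fintype.sum_prod_type_right]
  calc ∑ b : {x // x ∉ T} → Bool, ∑ a : {x // x ∈ T} → Bool,
        (if (∑ i, (if e.symm (a, b) i then (1 : ℤ) else -1)) = k
          then ∏ i ∈ univ \ T, r i (e.symm (a, b) i) else 0)
      = ∑ b : {x // x ∉ T} → Bool, ∑ a : {x // x ∈ T} → Bool,
          (if (∑ i : {x // x ∈ T}, (if a i then (1 : ℤ) else -1))
              = k - ∑ i : {x // x ∉ T}, (if b i then (1 : ℤ) else -1)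
            then ∏ i : {x // x ∉ T}, r i (b i) else 0) := by
        refine Fintype.sum_congr _ _ (fun b => Fintype.sum_congr _ _ (fun a => ?_))
        simp only [hF a b, hS a b, eq_sub_iff_add_eq]
    _ = ∑ b : {x // x ∉ T} → Bool, (∏ i : {x // x ∉ T}, r i (b i)) *
          #((univ : Finset ({x // x ∈ T} → Bool)).filter
            (fun a => (∑ i : {x // x ∈ T}, (if a i then (1 : ℤ) else -1))
              = k - ∑ i : {x // x ∉ T}, (if b i then (1 : ℤ) else -1))) := by
        refine Fintype.sum_congr _ _ (fun b => ?_)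
        rw [← sum_filter, sum_const, nsmul_eq_mul, mul_comm]
    _ ≤ ∑ b : {x // x ∉ T} → Bool, (∏ i : {x // x ∉ T}, r i (b i)) *
          (T.card.choose (T.card / 2) : ℝ) := by
        refine sum_le_sum (fun b _ => mul_le_mul_of_nonneg_left ?_ (hGnn b))
        have := card_signs_eq_le {x // x ∈ T}
          (k - ∑ i : {x // x ∉ T}, (if b i then (1 : ℤ) else -1))
        rw [Fintype.card_coe] at this
        exact_mod_cast this
    _ = (T.card.choose (T.card / 2) : ℝ) * ∏ i ∈ univ \ T, (r i true + r i false) := by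
        rw [← sum_mul, mul_comm, hG]

/-- Real form of the middle binomial bound, linearised in `1/√(M+1)` by AM–GM:
`binom(M, ⌊M/2⌋) ≤ 2^M · (1/(2σ) + σ/(2(M+1)))` for every `σ > 0`. -/
private theorem middle_choose_le (M : ℕ) (σ : ℝ) (hσ : 0 < σ) :
    (M.choose (M / 2) : ℝ) ≤ 2 ^ M * (1 / (2 * σ) + σ / (2 * (M + 1))) := by
  have h1 : ((M : ℝ) + 1) * (M.choose (M / 2) : ℝ) ^ 2 ≤ ((2 : ℝ) ^ M) ^ 2 := by
    have h := middle_choose_sq_bound M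
    have h4 : ((4 : ℝ) ^ M) = ((2 : ℝ) ^ M) ^ 2 := by
      rw [sq, ← mul_pow]; norm_num
    rw [← h4]
    exact_mod_cast h
  set X : ℝ := (M.choose (M / 2) : ℝ) with hX_def
  set P : ℝ := (2 : ℝ) ^ M with hP_def
  have hP : 0 < P := by positivity
  have hM : (0 : ℝ) < (M : ℝ) + 1 := by positivity
  have key : 2 * σ * ((M : ℝ) + 1) * X ≤ P * (σ ^ 2 + ((M : ℝ) + 1)) := by
    have h2 : (2 * σ * ((M : ℝ) + 1) * X) * P ≤ (P * (σ ^ 2 + ((M : ℝ) + 1))) * P := by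
      nlinarith [sq_nonneg (σ * P - ((M : ℝ) + 1) * X),
        mul_le_mul_of_nonneg_left h1 hM.le]
    exact le_of_mul_le_mul_right h2 hP
  have h3 : P * (1 / (2 * σ) + σ / (2 * ((M : ℝ) + 1)))
      = P * (σ ^ 2 + ((M : ℝ) + 1)) / (2 * σ * ((M : ℝ) + 1)) := by
    field_simp
    ring
  rw [h3, le_div_iff₀ (by positivity)]
  linarith [key]

/-- Binomial average of `1/(M+1)`: for `M ~ Bin(N, q)` one has `(N+1) q · E[1/(M+1)] ≤ 1`,
written as a sum over subsets of `Fin N`. -/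
private theorem binomial_inv_succ_sum_le (N : ℕ) (q : ℝ) (hq1 : q ≤ 1) :
    ((N : ℝ) + 1) * q * ∑ T ∈ (univ : Finset (Fin N)).powerset,
        q ^ #T * (1 - q) ^ (N - #T) / (#T + 1) ≤ 1 := by
  have h1 : ∑ T ∈ (univ : Finset (Fin N)).powerset, q ^ #T * (1 - q) ^ (N - #T) / (#T + 1)
      = ∑ m ∈ range (N + 1), (N.choose m : ℝ) * (q ^ m * (1 - q) ^ (N - m) / (m + 1)) := by
    rw [Finset.sum_powerset_apply_card (fun m => q ^ m * (1 - q) ^ (N - m) / ((m : ℝ) + 1))]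
    simp [nsmul_eq_mul]
  have h2 : ∀ m : ℕ, ((N : ℝ) + 1) * (N.choose m : ℝ) / ((m : ℝ) + 1)
      = ((N + 1).choose (m + 1) : ℝ) := by
    intro m
    rw [div_eq_iff (by positivity)]
    exact_mod_cast Nat.add_one_mul_choose_eq N m
  have h3 : ((N : ℝ) + 1) * q * ∑ T ∈ (univ : Finset (Fin N)).powerset,
        q ^ #T * (1 - q) ^ (N - #T) / (#T + 1)
      = ∑ m ∈ range (N + 1), ((N + 1).choose (m + 1) : ℝ) * (q ^ (m + 1) * (1 - q) ^ (N - m)) := by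
    rw [h1, mul_sum]
    refine sum_congr rfl (fun m _ => ?_)
    rw [← h2 m]
    have : (m : ℝ) + 1 ≠ 0 := by positivity
    field_simp
    ring
  have h5 : (0 : ℝ) ≤ ((N + 1).choose 0 : ℝ) * (q ^ 0 * (1 - q) ^ (N + 1 - 0)) :=
    mul_nonneg (by positivity) (mul_nonneg (by positivity) (pow_nonneg (by linarith) _))
  calc ((N : ℝ) + 1) * q * ∑ T ∈ (univ : Finset (Fin N)).powerset,
        q ^ #T * (1 - q) ^ (N - #T) / (#T + 1)
      = ∑ m ∈ range (N + 1), ((N + 1).choose (m + 1) : ℝ) * (q ^ (m + 1) * (1 - q) ^ (N - m)) := h3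
    _ ≤ ∑ m ∈ range (N + 1), ((N + 1).choose (m + 1) : ℝ) * (q ^ (m + 1) * (1 - q) ^ (N - m))
          + ((N + 1).choose 0 : ℝ) * (q ^ 0 * (1 - q) ^ (N + 1 - 0)) := le_add_of_nonneg_right h5
    _ = ∑ m ∈ range (N + 1 + 1), ((N + 1).choose m : ℝ) * (q ^ m * (1 - q) ^ (N + 1 - m)) := by
        rw [Finset.sum_range_succ'
          (fun m => ((N + 1).choose m : ℝ) * (q ^ m * (1 - q) ^ (N + 1 - m))) (N + 1)]
        simp only [Nat.add_sub_add_right]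
    _ = (q + (1 - q)) ^ (N + 1) := by
        rw [add_pow]
        exact sum_congr rfl (fun m _ => by ring)
    _ = 1 := by simp

/-- **Stub S4 (Littlewood–Offord / Erdős anti-concentration for biased signs).**
For every `ε > 0` there is `C` such that for independent signs `s_i = ±1` with
`P(s_i = +1) = p_i ∈ [ε, 1-ε]`, every atom `P(∑ i, s_i = k)` is at most `C / √(N+1)`; here the
probability is the finite sum over sign patterns of the product weights. -/
theorem stub_littlewoodOfford :
    ∀ ε : ℝ, 0 < ε → ∃ C : ℝ, ∀ (N : ℕ) (p : Fin N → ℝ), (∀ i, ε ≤ p i ∧ p i ≤ 1 - ε) → ∀ k : ℤ,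
      (∑ s ∈ (Finset.univ : Finset (Fin N → Bool)).filter
          (fun s => (∑ i, (if s i then (1 : ℤ) else -1)) = k),
        ∏ i, (if s i then p i else 1 - p i)) ≤ C / Real.sqrt (N + 1) := by
  intro ε hε
  refine ⟨1 + 1 / (4 * ε), fun N p hp k => ?_⟩
  have hC1 : (1 : ℝ) ≤ 1 + 1 / (4 * ε) := by
    have : (0 : ℝ) ≤ 1 / (4 * ε) := by positivity
    linarith
  have hw : ∀ (s : Fin N → Bool) (i : Fin N), 0 ≤ (if s i then p i else 1 - p i) := by
    intro s i
    have := hp i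
    split <;> linarith [this.1, this.2]
  rcases Nat.eq_zero_or_pos N with rfl | hN
  · -- `N = 0`: the sum has at most one term, equal to `1`.
    have h1 : ∑ s ∈ (Finset.univ : Finset (Fin 0 → Bool)).filter
          (fun s => (∑ i, (if s i then (1 : ℤ) else -1)) = k),
            ∏ i, (if s i then p i else 1 - p i)
        ≤ ∑ s : Fin 0 → Bool, ∏ i, (if s i then p i else 1 - p i) :=
      sum_le_sum_of_subset_of_nonneg (filter_subset _ _)
        (fun s _ _ => prod_nonneg (fun i _ => hw s i))
    have h2 : ∑ s : Fin 0 → Bool, ∏ i, (if s i then p i else 1 - p i) = 1 := by simp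
    calc _ ≤ (1 : ℝ) := h1.trans h2.le
      _ ≤ (1 + 1 / (4 * ε)) / Real.sqrt ((0 : ℕ) + 1) := by simpa using hC1
  · -- `N ≥ 1`: then `2ε ≤ 1`.
    have hε2 : 2 * ε ≤ 1 := by
      have := hp ⟨0, hN⟩
      linarith [this.1, this.2]
    set q : ℝ := 2 * ε with hq
    set r : Fin N → Bool → ℝ := fun i b => if b then p i - ε else 1 - p i - ε with hr_def
    have hr : ∀ i b, 0 ≤ r i b := by
      intro i b
      have := hp i
      cases b
      · simp only [hr_def, Bool.false_eq_true, if_false]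
        linarith [this.2]
      · simp only [hr_def, if_true]
        linarith [this.1]
    have hr2 : ∀ i, r i true + r i false = 1 - q := by
      intro i
      simp only [hr_def, Bool.false_eq_true, if_false, if_true, hq]
      ring
    have hw' : ∀ s : Fin N → Bool,
        ∏ i, (if s i then p i else 1 - p i) = ∏ i, (ε + r i (s i)) := by
      intro s
      refine prod_congr rfl (fun i _ => ?_)
      rcases Bool.eq_false_or_eq_true (s i) with h | h
      · simp [h, hr_def]
      · simp [h, hr_def]
    -- the set of sign patterns with signed sum `k`
    set A := (Finset.univ : Finset (Fin N → Bool)).filter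
      (fun s => (∑ i, (if s i then (1 : ℤ) else -1)) = k) with hA
    -- Step 1: mixture expansion and exchange of sums.
    have step1 : ∑ s ∈ A, ∏ i, (if s i then p i else 1 - p i)
        = ∑ T ∈ (univ : Finset (Fin N)).powerset,
            ε ^ #T * ∑ s ∈ A, ∏ i ∈ univ \ T, r i (s i) := by
      calc ∑ s ∈ A, ∏ i, (if s i then p i else 1 - p i)
          = ∑ s ∈ A, ∑ T ∈ (univ : Finset (Fin N)).powerset,
              ε ^ #T * ∏ i ∈ univ \ T, r i (s i) := by
            refine sum_congr rfl (fun s _ => ?_)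
            rw [hw' s, prod_add]
            refine sum_congr rfl (fun T _ => ?_)
            rw [prod_const]
        _ = _ := by
            rw [sum_comm]
            refine sum_congr rfl (fun T _ => ?_)
            rw [mul_sum]
    -- Step 2: conditional bound for each set `T` of fair coordinates.
    have step2 : ∀ T : Finset (Fin N), ∑ s ∈ A, ∏ i ∈ univ \ T, r i (s i)
        ≤ ((#T).choose (#T / 2) : ℝ) * (1 - q) ^ (N - #T) := by
      intro T
      have := sum_filter_prod_sdiff_le N T r hr k
      rwa [prod_congr rfl (fun i _ => hr2 i), prod_const, Finset.card_univ_sdiff,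
        Fintype.card_fin] at this
    -- Step 3: the middle binomial coefficient, linearised with `a = 1/√(N+1)`.
    set σ : ℝ := Real.sqrt (N + 1) with hσ
    have hσpos : 0 < σ := Real.sqrt_pos.2 (by positivity)
    have hσ2 : σ ^ 2 = (N : ℝ) + 1 := Real.sq_sqrt (by positivity)
    have step3 : ∀ T : Finset (Fin N),
        ε ^ #T * (((#T).choose (#T / 2) : ℝ) * (1 - q) ^ (N - #T))
          ≤ (1 / (2 * σ)) * (q ^ #T * (1 - q) ^ (N - #T))
            + (σ / 2) * (q ^ #T * (1 - q) ^ (N - #T) / (#T + 1)) := by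
      intro T
      have hb := middle_choose_le #T σ hσpos
      have h1 : 0 ≤ ε ^ #T * (1 - q) ^ (N - #T) :=
        mul_nonneg (pow_nonneg hε.le _) (pow_nonneg (by linarith) _)
      calc ε ^ #T * (((#T).choose (#T / 2) : ℝ) * (1 - q) ^ (N - #T))
          = (ε ^ #T * (1 - q) ^ (N - #T)) * ((#T).choose (#T / 2) : ℝ) := by ring
        _ ≤ (ε ^ #T * (1 - q) ^ (N - #T))
              * (2 ^ #T * (1 / (2 * σ) + σ / (2 * ((#T : ℝ) + 1)))) :=
            mul_le_mul_of_nonneg_left hb h1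
        _ = _ := by
            rw [hq, mul_pow]
            simp only [← div_div]
            ring
    -- Step 4: the two binomial averages.
    have hsumA : ∑ T ∈ (univ : Finset (Fin N)).powerset, q ^ #T * (1 - q) ^ (N - #T) = 1 := by
      have := Finset.sum_pow_mul_eq_add_pow q (1 - q) (univ : Finset (Fin N))
      rw [card_univ, Fintype.card_fin] at this
      rw [this, hq]
      simp
    have hsumB : ∑ T ∈ (univ : Finset (Fin N)).powerset,
        q ^ #T * (1 - q) ^ (N - #T) / (#T + 1) ≤ 1 / ((N + 1) * q) := by
      have := binomial_inv_succ_sum_le N q hε2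
      rw [le_div_iff₀ (by positivity)]
      calc _ = ((N : ℝ) + 1) * q * ∑ T ∈ (univ : Finset (Fin N)).powerset,
            q ^ #T * (1 - q) ^ (N - #T) / (#T + 1) := by ring
        _ ≤ 1 := this
    -- Assembly.
    calc ∑ s ∈ A, ∏ i, (if s i then p i else 1 - p i)
        = ∑ T ∈ (univ : Finset (Fin N)).powerset,
            ε ^ #T * ∑ s ∈ A, ∏ i ∈ univ \ T, r i (s i) := step1
      _ ≤ ∑ T ∈ (univ : Finset (Fin N)).powerset,
            ε ^ #T * (((#T).choose (#T / 2) : ℝ) * (1 - q) ^ (N - #T)) :=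
          sum_le_sum (fun T _ => mul_le_mul_of_nonneg_left (step2 T) (pow_nonneg hε.le _))
      _ ≤ ∑ T ∈ (univ : Finset (Fin N)).powerset,
            ((1 / (2 * σ)) * (q ^ #T * (1 - q) ^ (N - #T))
              + (σ / 2) * (q ^ #T * (1 - q) ^ (N - #T) / (#T + 1))) :=
          sum_le_sum (fun T _ => step3 T)
      _ = (1 / (2 * σ)) * ∑ T ∈ (univ : Finset (Fin N)).powerset, q ^ #T * (1 - q) ^ (N - #T)
            + (σ / 2) * ∑ T ∈ (univ : Finset (Fin N)).powerset,
                q ^ #T * (1 - q) ^ (N - #T) / (#T + 1) := by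
          rw [sum_add_distrib, mul_sum, mul_sum]
      _ ≤ (1 / (2 * σ)) * 1 + (σ / 2) * (1 / ((N + 1) * q)) := by
          rw [hsumA]
          gcongr
      _ = (1 / 2 + 1 / (4 * ε)) / σ := by
          rw [hq, ← hσ2]
          field_simp
          ring
      _ ≤ (1 + 1 / (4 * ε)) / σ := div_le_div_of_nonneg_right (by linarith) hσpos.le

end Summit.QuantumFields.QCD.Cruxes.WindowExtinction.FreeVolumeHeavyWitness

end
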